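import Mathlib.Combinatorics.SetFamily.HarrisKleitman
import Mathlib.Combinatorics.Hall.Basic
import Mathlib.Data.Complex.Basic
import Mathlib.Algebra.BigOperators.Ring.Finset

/-!
# Support item `AnchoredDoorHitsLowerPairs` (stmt-ValiantsHypothesis-22510), line `anchored-peeling`:
# CONJECTURE L (Boolean Lefschetz for door elements) — typed statement, and the Harris–Kleitman matching it rests on

Helper file (`--supports stmt-ValiantsHypothesis-22510`; cell valiant-natproofs, rung V4, 𝒟-side door (c); registered line
`Cruxes/AnchoredDoorHitsLowerPairs/Lines/anchored_peeling.lean` v12; prover seat val-np-p1 gen 19, memo PEEL-HALL §20–§22). Closes NO item.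

BRANCH (i) OF THE FIXED-PROFILE RESIDUAL. After the UQ_s-steps (files `…UQStep`, `…UQFaceStep`) the pairs left at a fixed profile `s` are «deep versus
middle-ball»: the cube `2^X` (`|X| = n`) against a lower family `C` of `2^n` faces on `n+1` vertices (memo §19). Peeling ALL vertices of `C` but one onto the
cube's vertices with bare anchors (the TOTAL MULTI-PEEL, memo §20) specialises the profile-1 door determinant to `± det M(K,D)`, where
`K = lk_{c₀} C ⊆ D = del_{c₀} C` are lower families in `2^X` with `|K| + |D| = 2^n` (a BALANCED PAIR) and
`M(K,D)[U,B] = [B ⊆ U] · g(U ∖ B)`, rows `U ∈ 2^X ∖ D`, columns `B ∈ K`, `g(V) = Σ_{b∈V} θ_b ∏_{b'∈V∖b} φ_{bb'}` (the coefficients of the door element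
`Q = Σ_b θ_b x_b ∏_{b'≠b}(1 + φ_{bb'}x_{b'})` of the zeon algebra `Z_X`). CONJECTURE L: `det M(K,D) ≠ 0` for generic `θ, φ`, i.e. `Z_X = P_D ⊕ Q·P_K`.
Numerics (lab/exp_conjL*.py, kit j303920): 1 800/1 800 random balanced pairs with `n ≤ 7`, 0 failures; the specialisations `Q = F(ℓ)` (radial), `Q = ℓ`,
`Q = ℓ·e^{m}` FAIL, so the statement is NOT a consequence of the sl₂ / hard-Lefschetz structure of the Boolean lattice.

* `ConjL.doorCoeff`, `Stmt.stub_conjL` — the conjecture, typed determinant-free: for every balanced pair there are complex parameters for which the columns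
  `(g(U∖B))_{U ∉ D}`, `B ∈ K`, are linearly independent (equivalently `det ≠ 0`, the matrix being square).
* `ConjL.card_inter_add_card_inter_le` — for a balanced pair and any UPPER family `𝒱`: `|𝒱 ∩ K| + |𝒱 ∩ D| ≤ |𝒱|` (two Harris–Kleitman inequalities summed).
* `ConjL.hall_condition`, `ConjL.exists_injective_strictSuperset` — hence Hall's condition holds for the strict-inclusion graph between `K` and `2^X ∖ D`, and
  there is an injection `f : K → 2^X ∖ D` with `B ⊊ f B`: the support of `M(K,D)` carries a perfect matching (necessary for `det ≠ 0`, and the skeleton of every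
  leading-term argument). Memo §21(b) shows this is NOT sufficient even for a generic set function `g` (a 4×4 cancelling configuration), so Conjecture L is a
  genuine statement about lower/upper pairs; §22 reduces `L(n)` to `L(n−1)` plus an `e×e` cross-isomorphism — the one-algebra shadow of the UQ-step pairing.

WHAT THIS IS NOT: no proof of Conjecture L, no formalisation of the multi-peel reduction; nothing on crux stmt-ValiantsHypothesis-14610 or on `VP` versus `VNP`.
-/

set_option linter.dupNamespace false

namespace Summit.ValiantsHypothesis.ValiantsHypothesis.Theorems.BarrierLever.AnchoredPeeling

open Finset

/-- The door coefficient `g(V) = Σ_{b∈V} θ_b ∏_{b'∈V∖{b}} φ_{b b'}` — the coefficient of `x^V` in `Σ_b θ_b x_b ∏_{b'≠b}(1 + φ_{bb'} x_{b'})`. -/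
def ConjL.doorCoeff {n : ℕ} (θ : Fin n → ℂ) (φ : Fin n → Fin n → ℂ) (V : Finset (Fin n)) : ℂ :=
  ∑ b ∈ V, θ b * ∏ b' ∈ V.erase b, φ b b'

/-- **Conjecture L** (Boolean Lefschetz for door elements, memo PEEL-HALL §20), determinant-free form: for every balanced lower pair `K ⊆ D ⊆ 2^[n]`
(`|K| + |D| = 2^n`) there are parameters `θ, φ` such that a coefficient vector `c` on `K` with `Σ_{B∈K, B⊆U} c_B · g(U∖B) = 0` for every non-face `U ∉ D`
vanishes identically. (Rows `U ∉ D` and columns `B ∈ K` are equinumerous, so this says `det [ [B⊆U] g(U∖B) ] ≠ 0`.) By the total multi-peel it implies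
`U1(2^X, C)` for every lower `C` on `|X|+1` vertices. UNPROVED; numerics 1 800/1 800 (n ≤ 7). -/
def Stmt.stub_conjL : Prop :=
  ∀ (n : ℕ) (K D : Finset (Finset (Fin n))), IsLowerSet (K : Set (Finset (Fin n))) → IsLowerSet (D : Set (Finset (Fin n))) →
    K ⊆ D → K.card + D.card = 2 ^ n →
    ∃ (θ : Fin n → ℂ) (φ : Fin n → Fin n → ℂ), ∀ c : Finset (Fin n) → ℂ,
      (∀ U : Finset (Fin n), U ∉ D → ∑ B ∈ K.filter (· ⊆ U), c B * ConjL.doorCoeff θ φ (U \ B) = 0) → ∀ B ∈ K, c B = 0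

section Matching

variable {α : Type*} [DecidableEq α] [Fintype α]

/-- **Balanced pairs repel upper families.** If `K, D` are lower families of subsets of a finite type with `|K| + |D| = 2^{|α|}`, then every upper family `𝒱`
satisfies `|𝒱 ∩ K| + |𝒱 ∩ D| ≤ |𝒱|`: sum the two Harris–Kleitman anticorrelation inequalities `2^{|α|}·|𝒱 ∩ K| ≤ |𝒱|·|K|`, `2^{|α|}·|𝒱 ∩ D| ≤ |𝒱|·|D|`. -/
theorem ConjL.card_inter_add_card_inter_le (K D 𝒱 : Finset (Finset α)) (hK : IsLowerSet (K : Set (Finset α)))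
    (hD : IsLowerSet (D : Set (Finset α))) (h𝒱 : IsUpperSet (𝒱 : Set (Finset α))) (hcard : #K + #D = 2 ^ Fintype.card α) :
    #(𝒱 ∩ K) + #(𝒱 ∩ D) ≤ #𝒱 := by
  have h1 := h𝒱.card_inter_le_finset hK
  have h2 := h𝒱.card_inter_le_finset hD
  have hpos : 0 < 2 ^ Fintype.card α := Nat.two_pow_pos _
  have key : 2 ^ Fintype.card α * (#(𝒱 ∩ K) + #(𝒱 ∩ D)) ≤ 2 ^ Fintype.card α * #𝒱 := by
    calc 2 ^ Fintype.card α * (#(𝒱 ∩ K) + #(𝒱 ∩ D))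
        = 2 ^ Fintype.card α * #(𝒱 ∩ K) + 2 ^ Fintype.card α * #(𝒱 ∩ D) := by ring
      _ ≤ #𝒱 * #K + #𝒱 * #D := add_le_add h1 h2
      _ = #𝒱 * (#K + #D) := by ring
      _ = 2 ^ Fintype.card α * #𝒱 := by rw [hcard, mul_comm]
  exact Nat.le_of_mul_le_mul_left key hpos

/-- **Hall's condition for a balanced pair.** For `A ⊆ K`, the non-faces of `D` containing some member of `A` are at least `|A|` in number. (Replace `A` by the
upper family `𝒱` it generates: `A ⊆ 𝒱 ∩ K` and `|𝒱 ∩ K| ≤ |𝒱| − |𝒱 ∩ D| = |𝒱 ∖ D|`.) -/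
theorem ConjL.hall_condition (K D : Finset (Finset α)) (hK : IsLowerSet (K : Set (Finset α))) (hD : IsLowerSet (D : Set (Finset α)))
    (hcard : #K + #D = 2 ^ Fintype.card α) (A : Finset (Finset α)) (hA : A ⊆ K) :
    #A ≤ #((univ \ D).filter (fun U => ∃ B ∈ A, B ⊆ U)) := by
  set 𝒱 : Finset (Finset α) := univ.filter (fun U => ∃ B ∈ A, B ⊆ U) with h𝒱def
  have h𝒱 : IsUpperSet (𝒱 : Set (Finset α)) := by
    intro U U' hUU' hU
    rw [mem_coe, h𝒱def, mem_filter] at hU ⊢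
    obtain ⟨-, B, hB, hBU⟩ := hU
    exact ⟨mem_univ _, B, hB, hBU.trans hUU'⟩
  have hA𝒱K : A ⊆ 𝒱 ∩ K := by
    intro B hB
    rw [mem_inter]
    exact ⟨mem_filter.mpr ⟨mem_univ _, B, hB, Subset.rfl⟩, hA hB⟩
  have key := ConjL.card_inter_add_card_inter_le K D 𝒱 hK hD h𝒱 hcard
  have hsplit : #(𝒱 \ D) + #(𝒱 ∩ D) = #𝒱 := card_sdiff_add_card_inter 𝒱 D
  have htarget : (univ \ D).filter (fun U => ∃ B ∈ A, B ⊆ U) = 𝒱 \ D := by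
    ext U
    simp only [h𝒱def, mem_filter, mem_sdiff, mem_univ, true_and]
    tauto
  rw [htarget]
  calc #A ≤ #(𝒱 ∩ K) := card_le_card hA𝒱K
    _ ≤ #(𝒱 \ D) := by omega

/-- **A balanced pair carries a strict-inclusion matching.** If `K ⊆ D` are lower families with `|K| + |D| = 2^{|α|}`, there is an injection `f` from `K` into the
non-faces of `D` with `B ⊊ f B` for every `B ∈ K` (Hall's marriage theorem on `ConjL.hall_condition`). In particular the support pattern `[B ⊆ U]` of the
Conjecture-L matrix `M(K,D)` has a perfect matching. -/
theorem ConjL.exists_injective_strictSuperset (K D : Finset (Finset α)) (hK : IsLowerSet (K : Set (Finset α)))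
    (hD : IsLowerSet (D : Set (Finset α))) (hKD : K ⊆ D) (hcard : #K + #D = 2 ^ Fintype.card α) :
    ∃ f : K → Finset α, Function.Injective f ∧ ∀ B : K, (B : Finset α) ⊂ f B ∧ f B ∉ D := by
  classical
  let t : K → Finset (Finset α) := fun B => (univ \ D).filter (fun U => (B : Finset α) ⊆ U)
  have hall : ∀ s : Finset K, #s ≤ #(s.biUnion t) := by
    intro s
    set A : Finset (Finset α) := s.map (Function.Embedding.subtype _) with hAdef
    have hAK : A ⊆ K := by
      intro B hB
      rw [hAdef, mem_map] at hB
      obtain ⟨x, -, rfl⟩ := hB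
      exact x.2
    have hcardA : #A = #s := by rw [hAdef, card_map]
    have hbi : s.biUnion t = (univ \ D).filter (fun U => ∃ B ∈ A, B ⊆ U) := by
      ext U
      simp only [mem_biUnion, t, hAdef, mem_filter, mem_sdiff, mem_univ, true_and, mem_map, Function.Embedding.coe_subtype]
      constructor
      · rintro ⟨x, hx, hUD, hxU⟩
        exact ⟨hUD, x, ⟨x, hx, rfl⟩, hxU⟩
      · rintro ⟨hUD, B, ⟨x, hx, rfl⟩, hxU⟩
        exact ⟨x, hx, hUD, hxU⟩
    rw [hbi, ← hcardA]
    exact ConjL.hall_condition K D hK hD hcard A hAK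
  obtain ⟨f, hf, hft⟩ := (all_card_le_biUnion_card_iff_exists_injective t).mp hall
  refine ⟨f, hf, fun B => ?_⟩
  have hB := hft B
  simp only [t, mem_filter, mem_sdiff, mem_univ, true_and] at hB
  obtain ⟨hfD, hsub⟩ := hB
  refine ⟨ssubset_of_subset_of_ne hsub ?_, hfD⟩
  intro h
  exact hfD (h ▸ hKD B.2)

end Matching

end Summit.ValiantsHypothesis.ValiantsHypothesis.Theorems.BarrierLever.AnchoredPeeling
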